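import Mathlib
import Literature.MathematicalPhysics.QuantumFieldTheory.Balaban1983to89.Beta.WindowIdentification
import Literature.MathematicalPhysics.QuantumFieldTheory.Balaban1983to89.B12Sec2to5

/-!
# `BalabanUV.Beta.FP.TailShellBound` — road «FP» for binder row D1, N7 ∕ `hrep` row «TAILS» (amplitude half): THE SHELL BOUND `htail` OF
# `FP/RepAssembly.hrep_of_basePoint` FROM A POINTWISE EXPONENTIAL DECAY OF THE BASE-POINT KERNEL — amplitude `E = |a|·C·720·(2/θ)⁶`, rate `θ/2`
# (β sub-cell, D1 formalisation swarm, unit `b2b-balaban-beta-d1-formalise-leaf-06`, gen 3; sub-row «TAILS-SHELL» of `LEAVES-FP.md`)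

NOT IN PRINT; OUR BOOKKEEPING.  HONEST FRAMING (cell charter, verbatim): «discharging `BetaPertH` makes Bałaban's UV stability UNCONDITIONAL — a real
constructive-QFT result; it is NOT the continuum limit and NOT the Clay problem.»  HONEST DEPENDENCY (verbatim): «continuum YM on T⁴ ⇐ BetaPertH ∧ nine spine
estimates (0/9 proved); BetaPertH ⇐ (D1) ∧ (D4) ∧ CAP+tail; G-an2-4 gates asym, D1 and NE2/3/4.»  [folklore] real analysis (`x⁶ ≤ 6!·e^{x}` via
`Real.pow_div_factorial_le_exp`) and the sup-norm ∕ ℓ¹ comparison on `ℤ⁴`; no statement of Bałaban's papers, no `[cite:]`, no `def`, no `def … : Prop`;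
instantiates NO binder of the β-function wall; it is NOT the TAILS row itself (the decay INPUT — a pointwise bound `|P b w| ≤ C·e^{−θ|w|₁}` for the base-point
kernels of the fine Hessian of the perfect objects at blocking `n`, with its `n`-dependence — is the instantiator's: `D1BFx/DressedTablesLeg.exists_decay_*`
shapes, rate from gan24-p3-g15's «KPERF-TAIL-RATE»).  NOT `hrep`, NOT N7, NOT D1, NOT `BetaPertH`, NOT continuum, NOT Clay.

* `pow_six_mul_exp_neg_le` : `0 < θ ⇒ x⁶ · e^{−(θ/2)·x} ≤ 720 · (2/θ)⁶` (`x ≥ 0`).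
* `succ_le_l1_of_mem_annulus`, `abs_toReal_le_succ_of_mem_annulus` : on the shell `annulus 4 r (r+1)` one has `r + 1 ≤ |w|₁` and `|w_μ| ≤ r + 1`.
* **`htail_of_decay`** : `|P w| ≤ C·e^{−θ|w|₁}` for all `w` (`0 ≤ C`, `0 < θ`) ⇒ for `Φ w := a · (w_μ · w_ν · P w)`:
  `∀ r, ∀ w ∈ annulus 4 r (r+1), |Φ w| ≤ E ∕ (r+1)⁴ · e^{−((θ/2)/1)·(r+1)}` with `E := |a| · C · 720 · (2/θ)⁶` — EXACTLY the `htail` binder shape of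
  `FP/RepAssembly.hrep_of_basePoint` (`δ := θ/2`, `Lr := 1`, `M := 0`); `htail_of_decay'` the same with `(δ, Lr) := (θ·Lr/2, Lr)` for any `Lr > 0`
  (the owner's `Lr := n` convention).
Provenance: D1 formalisation swarm, leaf prover 06 (gen 3), 2026-08-20; no existing file touched.
-/

noncomputable section

open Finset Real
open scoped BigOperators

namespace Summit.QuantumFields.BalabanUV.Beta.FP.TailShellBound

open Literature.Probability.LatticeModels (annulus)
open Literature.MathematicalPhysics.QuantumFieldTheory.Balaban1983to89.B12Sec2to5 (l1 l1_nonneg abs_coord_le_l1)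
open Literature.MathematicalPhysics.QuantumFieldTheory.Balaban1983to89.Beta.DyadicShell (Pt toReal toReal_apply supNorm natAbs_le_supNorm mem_annulus_iff)

/-- [folklore] `x⁶ · e^{−(θ/2)x} ≤ 720 · (2/θ)⁶` for `x ≥ 0`, `θ > 0` (from `y⁶/6! ≤ e^{y}` at `y = (θ/2)x`). -/
theorem pow_six_mul_exp_neg_le {θ x : ℝ} (hθ : 0 < θ) (hx : 0 ≤ x) :
    x ^ 6 * Real.exp (-(θ / 2) * x) ≤ 720 * (2 / θ) ^ 6 := by
  have hy : 0 ≤ θ / 2 * x := by positivity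
  have h := Real.pow_div_factorial_le_exp (x := θ / 2 * x) hy 6
  have h6 : ((Nat.factorial 6 : ℕ) : ℝ) = 720 := by norm_num [Nat.factorial]
  rw [h6, div_le_iff₀ (by norm_num : (0 : ℝ) < 720)] at h
  -- `(θ/2)^6 x^6 ≤ 720 e^{(θ/2) x}`; multiply by `e^{−(θ/2)x} (2/θ)^6`
  have hθ2 : 0 < θ / 2 := by positivity
  have e1 : x ^ 6 = (2 / θ) ^ 6 * (θ / 2 * x) ^ 6 := by
    rw [mul_pow, ← mul_assoc, ← mul_pow]; field_simp
  rw [e1, show -(θ / 2) * x = -(θ / 2 * x) by ring, mul_assoc]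
  calc (2 / θ) ^ 6 * ((θ / 2 * x) ^ 6 * Real.exp (-(θ / 2 * x)))
      ≤ (2 / θ) ^ 6 * 720 := by
        refine mul_le_mul_of_nonneg_left ?_ (by positivity)
        rw [Real.exp_neg]
        have hpos := Real.exp_pos (θ / 2 * x)
        rw [mul_inv_le_iff₀ hpos]
        linarith
    _ = 720 * (2 / θ) ^ 6 := by ring

/-- [folklore] On the shell `annulus 4 r (r+1)`: `r + 1 ≤ |w|₁`. -/
theorem succ_le_l1_of_mem_annulus {r : ℕ} {w : Pt} (hw : w ∈ annulus 4 r (r + 1)) : (r : ℝ) + 1 ≤ l1 w := by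
  rw [mem_annulus_iff] at hw
  obtain ⟨hlt, -⟩ := hw
  -- some coordinate has `natAbs > r`
  have : ∃ i : Fin 4, r < (w i).natAbs := by
    by_contra h
    push Not at h
    have : supNorm w ≤ r := Finset.sup_le fun i _ => h i
    omega
  obtain ⟨i, hi⟩ := this
  have h1 : ((r : ℝ) + 1) ≤ |(w i : ℝ)| := by
    have e : |(w i : ℝ)| = ((w i).natAbs : ℝ) := by
      rw [← Int.cast_abs, Int.abs_eq_natAbs]; simp
    rw [e]
    exact_mod_cast hi
  exact h1.trans (abs_coord_le_l1 w i)

/-- [folklore] On the shell `annulus 4 r (r+1)`: `|w_μ| ≤ r + 1`. -/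
theorem abs_toReal_le_succ_of_mem_annulus {r : ℕ} {w : Pt} (hw : w ∈ annulus 4 r (r + 1)) (μ : Fin 4) :
    |toReal w μ| ≤ (r : ℝ) + 1 := by
  rw [mem_annulus_iff] at hw
  obtain ⟨-, hle⟩ := hw
  have h1 : (w μ).natAbs ≤ r + 1 := (natAbs_le_supNorm w μ).trans hle
  rw [toReal_apply]
  have : |(w μ : ℝ)| = ((w μ).natAbs : ℝ) := by
    rw [← Int.cast_abs, Int.abs_eq_natAbs]; simp
  rw [this]
  exact_mod_cast h1

/-- [folklore] **THE SHELL BOUND `htail` FROM A POINTWISE EXPONENTIAL DECAY**: if `|P w| ≤ C·e^{−θ|w|₁}` for every `w` (`0 ≤ C`, `0 < θ`), then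
`Φ w := a · (w_μ · w_ν · P w)` satisfies, on every shell, `|Φ w| ≤ E/(r+1)⁴ · e^{−((θ/2)/1)(r+1)}` with `E := |a|·C·720·(2/θ)⁶` — the `htail` binder of
`FP/RepAssembly.hrep_of_basePoint` with `(E, δ, Lr, M) := (|a|·C·720·(2/θ)⁶, θ/2, 1, 0)`. -/
theorem htail_of_decay {P : Pt → ℝ} {C θ : ℝ} (hC : 0 ≤ C) (hθ : 0 < θ) (hP : ∀ w : Pt, |P w| ≤ C * Real.exp (-θ * l1 w))
    (a : ℝ) (μ ν : Fin 4) :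
    ∀ r : ℕ, 0 ≤ r → ∀ w ∈ annulus 4 r (r + 1),
      |a * (toReal w μ * toReal w ν * P w)|
        ≤ |a| * C * 720 * (2 / θ) ^ 6 / ((r : ℝ) + 1) ^ 4 * Real.exp (-(θ / 2 / 1) * ((r : ℝ) + 1)) := by
  intro r _ w hw
  have hr1 : (0 : ℝ) < (r : ℝ) + 1 := by positivity
  have hl := succ_le_l1_of_mem_annulus hw
  have hμ := abs_toReal_le_succ_of_mem_annulus hw μ
  have hν := abs_toReal_le_succ_of_mem_annulus hw ν
  -- |Φ| ≤ |a| (r+1)² C e^{−θ (r+1)}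
  have h1 : |a * (toReal w μ * toReal w ν * P w)| ≤ |a| * (((r : ℝ) + 1) ^ 2 * (C * Real.exp (-θ * ((r : ℝ) + 1)))) := by
    rw [abs_mul, abs_mul, abs_mul]
    refine mul_le_mul_of_nonneg_left ?_ (abs_nonneg a)
    have hP' : |P w| ≤ C * Real.exp (-θ * ((r : ℝ) + 1)) :=
      (hP w).trans (mul_le_mul_of_nonneg_left (Real.exp_le_exp.2 (by nlinarith)) hC)
    calc |toReal w μ| * |toReal w ν| * |P w| ≤ ((r : ℝ) + 1) * ((r : ℝ) + 1) * (C * Real.exp (-θ * ((r : ℝ) + 1))) :=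
          mul_le_mul (mul_le_mul hμ hν (abs_nonneg _) hr1.le) hP' (abs_nonneg _) (by positivity)
      _ = _ := by ring
  refine h1.trans ?_
  -- (r+1)^2 e^{−θ(r+1)} = (r+1)^{-4} · (r+1)^6 e^{−(θ/2)(r+1)} · e^{−(θ/2)(r+1)} ≤ (r+1)^{-4} · 720 (2/θ)^6 · e^{−(θ/2)(r+1)}
  have h6 := pow_six_mul_exp_neg_le hθ hr1.le
  have hexp : Real.exp (-θ * ((r : ℝ) + 1)) = Real.exp (-(θ / 2) * ((r : ℝ) + 1)) * Real.exp (-(θ / 2 / 1) * ((r : ℝ) + 1)) := by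
    rw [← Real.exp_add]; congr 1; ring
  rw [hexp]
  have hpos : 0 < Real.exp (-(θ / 2 / 1) * ((r : ℝ) + 1)) := Real.exp_pos _
  have hr4 : 0 < ((r : ℝ) + 1) ^ 4 := by positivity
  rw [div_mul_eq_mul_div, le_div_iff₀ hr4]
  have key : ((r : ℝ) + 1) ^ 2 * Real.exp (-(θ / 2) * ((r : ℝ) + 1)) * ((r : ℝ) + 1) ^ 4 ≤ 720 * (2 / θ) ^ 6 := by
    calc ((r : ℝ) + 1) ^ 2 * Real.exp (-(θ / 2) * ((r : ℝ) + 1)) * ((r : ℝ) + 1) ^ 4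
        = ((r : ℝ) + 1) ^ 6 * Real.exp (-(θ / 2) * ((r : ℝ) + 1)) := by ring
      _ ≤ 720 * (2 / θ) ^ 6 := h6
  calc |a| * (((r : ℝ) + 1) ^ 2 * (C * (Real.exp (-(θ / 2) * ((r : ℝ) + 1)) * Real.exp (-(θ / 2 / 1) * ((r : ℝ) + 1))))) * ((r : ℝ) + 1) ^ 4
      = |a| * C * (((r : ℝ) + 1) ^ 2 * Real.exp (-(θ / 2) * ((r : ℝ) + 1)) * ((r : ℝ) + 1) ^ 4) * Real.exp (-(θ / 2 / 1) * ((r : ℝ) + 1)) := by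
        ring
    _ ≤ |a| * C * (720 * (2 / θ) ^ 6) * Real.exp (-(θ / 2 / 1) * ((r : ℝ) + 1)) := by
        refine mul_le_mul_of_nonneg_right (mul_le_mul_of_nonneg_left key (by positivity)) hpos.le
    _ = |a| * C * 720 * (2 / θ) ^ 6 * Real.exp (-(θ / 2 / 1) * ((r : ℝ) + 1)) := by ring

/-- [folklore] The same in the owner's `(δ, Lr)` convention: for any `Lr > 0`, `(δ, Lr) := (θ·Lr/2, Lr)` gives `δ/Lr = θ/2`. -/
theorem htail_of_decay' {P : Pt → ℝ} {C θ : ℝ} (hC : 0 ≤ C) (hθ : 0 < θ) (hP : ∀ w : Pt, |P w| ≤ C * Real.exp (-θ * l1 w))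
    (a : ℝ) (μ ν : Fin 4) {Lr : ℝ} (hL : 0 < Lr) :
    ∀ r : ℕ, 0 ≤ r → ∀ w ∈ annulus 4 r (r + 1),
      |a * (toReal w μ * toReal w ν * P w)|
        ≤ |a| * C * 720 * (2 / θ) ^ 6 / ((r : ℝ) + 1) ^ 4 * Real.exp (-(θ * Lr / 2 / Lr) * ((r : ℝ) + 1)) := by
  have e : θ * Lr / 2 / Lr = θ / 2 / 1 := by field_simp
  rw [e]
  exact htail_of_decay hC hθ hP a μ ν

end Summit.QuantumFields.BalabanUV.Beta.FP.TailShellBound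

end
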